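import Summits.QuantumFields.YangMills.Theorems.BalabanUVNodesN15KingModelSrcDivCellOscillationL2
import Summits.QuantumFields.YangMills.Theorems.BalabanUVNodesN15TwoGridMeanZeroMultiplierSup
import Summits.QuantumFields.YangMills.Theorems.BalabanUVNodesN15KingModelFullPropagatorAdjGradHolderOperator
import HarnessLib

/-!
# BalabanUVNodes ∕ N15 — THE KING-MODEL RUNG, PROGRAMME Y (the dressed SOURCE-DIVERGENCE entry of the King jet), FILE 65:
# THE CELL-OSCILLATION ROW OF `A₀⁻¹N∇*_ν` IN SUP-BLOCK CURRENCY —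
# `(A₀′⁻¹N′∇′*_ν ⊗ 1)∘𝔇_{kingPrV}(M_{c′}, M_{blockAvg c′}) ≤ C·r·(L^K)^{−1∕(8(d+1))}·e^{−δ|y−y′|_T}`, NO letter on `∇c′`, uniform in `K`, the refinement `n`, the volume and the mass

WHO ∕ WHEN.  Cell `pub-ymgap`, seat `pub-ymgap-dag-n15-d` (R134, N15 NE2 s3 = King-model rung, g22); `--kind proof --supports stmt-QuantumFields-27366 --as helper`
(K3⁸; count-neutral).  THEOREMS ONLY (0 `def`).  Over FILE 64 (★★ `hasMajL2_kingSOp_comp_idef_mulOp_blockAvg`, the row in `L²`-block currency), dag-n15-e W-b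
`fullPropAdjOp_holder_le` ([B9] (3.43), second half, at `U ≡ 1`: the Hölder modulus of `A₀⁻¹∇*λ`), dag-n15-a part 70 `hasMaj_sup_of_l2Blocks_osc` (the
`L² → sup` interpolation on sub-boxes), part 56∕71 bookkeeping (`hasMaj_comp_diagK_const`, `sqrt_pow_mul_rpow_le`, `pow_rpow_neg_half_le`), n15-b
`hasMaj_idef_mulOp` and dag-n15-e Σ-a∕K-A `hasMaj_kingSOp_fine` ∕ `hasMaj_ofBlocks_of_cubeBound` BY NAME; nothing in the tree is modified.  The proof of §2 is
dag-n15-a K-I's (`hasMaj_gGrad_comp_idef_mulOp_blockAvg`) with the gradient of the pair of record replaced by the transposed gradient of King's propagator.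

WHY.  See FILE 64 (module docstring) and this seat's ARCHITECTURE NOTE «ENTRY 2 LIVE BY PARTS» (pub-ymgap INBOX l.43300): the by-parts fixed point of the
dressed third entry `Y = X∘N∇*_κ` needs the cell-oscillation row of the source-differenced propagator in the SUP-block currency that the η-defect device
(`T4EtaRateDefect.idef_neumann_majorant_flat`) and III-B consume; FILE 64 has it in `L²`; this file interpolates.

WHAT.  §1 `tdistT_add_smul_unitVec_le`, `symbOp_sT_pow_sub_one_comp_tensorId` (dictionary: `ρ(s_i^t − 1)∘(S ⊗ 1) = ((τ_{te_i} − 1)∘S) ⊗ 1`),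
★ `hasMaj_steps_tensorId_kingSOp` (W-b read as the oscillation rows: for `0 < α < 1`, `∃ C δ > 0`, every `K ≥ 1`, `n`, volume, `0 < m² ≤ m₀²`, `i ν`, `4t ≤ L^n·L^K`:
`HasMaj (ofBlocks fine) (ofBlocks fine) (ρ(s_i^t − 1)∘(kingSOp′_ν ⊗ 1)) (C·(t∕(L^nL^K))^α·e^{−δ|y−y′|_T})`); §2 ★★ `hasMaj_kingSOp_comp_idef_mulOp_blockAvg`:
`HasMaj (ofBlocks (unitTorusGeo L K M) (blkFine L K M)) (ofBlocks … (blockOf (L^n·L^K) M ∘ fst)) ((kingSOp′_ν ⊗ 1)∘𝔇_{kingPrV}(M_{c′}, M_{blockAvg c′}))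
(C·r·(L^K)^{−1∕(8(d+1))}·e^{−δ|y−y′|_T})` for `|c′| ≤ r`, `r ≥ 0` — HYPOTHESIS-FREE, uniform in `n`; the rate exponent `1∕(8(d+1))` is the interpolation's (K-I).

HONEST FRAMING ∕ LIMITS.  King's `A = 0` MODEL on finite tori (template literature [King1986] (2.13)–(2.17) p.653, (4.1)–(4.5) p.670), abelianised scalar
multipliers — NOT Bałaban's covariant `G(U)`; [Balaban1985BackgroundPropagators] (3.42)–(3.43) pp.397–398 ∕ (3.52) p.400 cited as SHAPE only; the rate exponent is a
currency artefact.  NE2⁺ NOT PRINTED ∕ NOT proved; no statement of record touched; N15 NOT discharged; K3⁸ OPEN; counts UNMOVED (typed 28∕28 · discharged 5∕27);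
one finite torus per index — NOT ℝ⁴ ∕ infinite volume ∕ OS ∕ mass gap ∕ Clay.
-/

noncomputable section

open scoped BigOperators Matrix
open Finset

namespace Summit.QuantumFields.YangMills.BalabanUVNodes.N15.KingModel.SrcDiv

open Literature.MathematicalPhysics.QuantumFieldTheory.Balaban1983to89
open Literature.MathematicalPhysics.QuantumFieldTheory.Balaban1983to89.B11SectG (BlockNorm HasMaj hasMaj_zero)
open Literature.MathematicalPhysics.QuantumFieldTheory.Balaban1983to89.B11AxialTransport190 (abs_le_loc_ofBlocks loc_ofBlocks_le)
open Literature.MathematicalPhysics.QuantumFieldTheory.Balaban1983to89.T4EtaRateDefect (idef idef_apply)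
open Literature.MathematicalPhysics.QuantumFieldTheory.Balaban1983to89.T4EtaRateCoeffDefect (pull pull_apply diagK blockAvg hasMaj_idef_mulOp)
open Literature.MathematicalPhysics.QuantumFieldTheory.Balaban1983to89.B6Prop26Gluing (mulOp mulOp_apply)
open Literature.MathematicalPhysics.QuantumFieldTheory.Balaban1983to89.B5Prop11Plancherel (Tor fine unitVec)
open Literature.MathematicalPhysics.QuantumFieldTheory.Balaban1983to89.B5SettingP12Weighted (etaPow etaPow_nonneg)
open Literature.MathematicalPhysics.QuantumFieldTheory.King1986 (aK)
open Literature.MathematicalPhysics.QuantumFieldTheory.King1986.Torus (fineOp blockOf tdistT tdistT_nonneg tdistT_symm tdistT_self tdistT_triangle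
  tdistT_add_unitVec_le)
open Literature.MathematicalPhysics.QuantumFieldTheory.Balaban1983to89.B6UnitTorusCarrier (unitTorusGeo)
open Summit.QuantumFields.YangMills.BalabanUVNodes.N15.VectorPiece (kingPrV blkFine blkFine_comp_kingPrV tensorId tensorId_apply hasMaj_tensorId unitTorusGeoS)
open Summit.QuantumFields.YangMills.BalabanUVNodes.N15.TwoGrid (symbOp sT sTinv symbOp_sT_pow_sub_one_apply hasMaj_sup_of_l2Blocks_osc hasMaj_comp_diagK_const
  sqrt_pow_mul_rpow_le pow_rpow_neg_half_le tdistT_blockOf_add_smul_le)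
open Summit.QuantumFields.YangMills.BalabanUVNodes.N15.TwoGrid.KingJet (blockOf_comp_underPtN)
open Summit.QuantumFields.YangMills.BalabanUVNodes.N15.BackgroundLayer (abs_blockAvg_le)
open Summit.QuantumFields.YangMills.BalabanUVNodes.N15KingModelRung.Curved (kingGOp kingSOp kingGOp_apply kingSOp_apply underPtN fullPropAdjOp_holder_le
  hasMaj_kingSOp_fine hasMaj_ofBlocks_of_cubeBound one_le_tdistT_of_ne)

variable {d : ℕ} (L : ℕ) [NeZero L]

/-! ## §1 W-b read as the oscillation rows `ρ(s_i^t − 1)∘(A₀⁻¹N∇*_ν ⊗ 1)` -/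

section Steps

variable (N : ℕ) [NeZero N] (M : Fin (d + 1) → ℕ) [∀ μ, NeZero (M μ)]

omit [NeZero L] in
/-- `t` lattice steps move a point by at most `t` in King's periodic sup-distance. [folklore] -/
theorem tdistT_add_smul_unitVec_le (x : Tor (fine N M)) (i : Fin (d + 1)) (t : ℕ) :
    tdistT (fine N M) x (x + t • unitVec (fine N M) i) ≤ t := by
  induction t with
  | zero => rw [zero_smul, add_zero, tdistT_self]; exact le_of_eq (by simp)
  | succ t ih =>
    rw [succ_nsmul, ← add_assoc]
    have h1 := tdistT_add_unitVec_le (fine N M) (x + t • unitVec (fine N M) i) i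
    have h2 := tdistT_triangle (fine N M) x (x + t • unitVec (fine N M) i) (x + t • unitVec (fine N M) i + unitVec (fine N M) i)
    push_cast
    linarith

omit [NeZero L] [NeZero N] [∀ μ, NeZero (M μ)] in
/-- DICTIONARY: `ρ(s_i^t − 1)∘(S ⊗ 1) = ((τ_{te_i} − 1)∘S) ⊗ 1` — the `t`-step output difference of a lifted scalar operator is the lift of the scalar `t`-step difference.
[folklore] -/
theorem symbOp_sT_pow_sub_one_comp_tensorId (S : (Tor (fine N M) → ℝ) →ₗ[ℝ] (Tor (fine N M) → ℝ)) (i : Fin (d + 1)) (t : ℕ) :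
    symbOp M N (sT M N i ^ t - 1) ∘ₗ tensorId (Fin (d + 1)) S
      = tensorId (Fin (d + 1)) ((pull (fun x : Tor (fine N M) => x + t • unitVec (fine N M) i) - LinearMap.id) ∘ₗ S) := by
  refine LinearMap.ext fun f => funext fun p => ?_
  rw [LinearMap.comp_apply, symbOp_sT_pow_sub_one_apply, tensorId_apply, tensorId_apply, tensorId_apply, LinearMap.comp_apply, LinearMap.sub_apply,
    Pi.sub_apply, pull_apply, LinearMap.id_apply]

variable {L}

/-- ★ **THE OSCILLATION ROWS OF THE THIRD ENTRY — dag-n15-e W-b `fullPropAdjOp_holder_le` read as block majorants.**  For odd `L ≥ 3`, `a > 0`, `m₀² ≥ 0` and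
`0 < α < 1`: `∃ C δ > 0` such that for every `K ≥ 1`, refinement `n`, cube `M_μ = 2L^e`, mass `0 < m² ≤ m₀²`, directions `i, ν` and step count `t` with
`4t ≤ L^n·L^K`, on the fine coloured carrier (King's unit blocks through the first coordinate):
`HasMaj (ofBlocks) (ofBlocks) (ρ(s_i^t − 1)∘(A₀′⁻¹N′∇′*_ν ⊗ 1)) (C·(t∕(L^n·L^K))^α·e^{−δ|y−y′|_T})` — `t` fine steps of the OUTPUT of the transposed gradient cost
`(t∕N′)^α` against a block-localised SUP-normed source. [cite: Balaban1985BackgroundPropagators, Thm 3.1 (3.43) p.398 (second Hölder norm, shape);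
Balaban1983RegularityDecay, Theorem (1.9) p.573; King1986, (2.13) p.653, Prop. 3.7 (3.65) p.663] -/
theorem hasMaj_steps_tensorId_kingSOp (hLodd : Odd L) (hL : 2 ≤ L) {a : ℝ} (ha : 0 < a) {m0sq : ℝ} (hm0 : 0 ≤ m0sq) {α : ℝ} (hα0 : 0 < α) (hα1 : α < 1) :
    ∃ C δ : ℝ, 0 < C ∧ 0 < δ ∧ ∀ (K : ℕ), 1 ≤ K → ∀ (n e : ℕ) (M : Fin (d + 1) → ℕ) [∀ μ, NeZero (M μ)], (∀ μ, M μ = 2 * L ^ e) →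
      ∀ (msq : ℝ), 0 < msq → msq ≤ m0sq → ∀ (i ν : Fin (d + 1)) (t : ℕ), 4 * t ≤ L ^ n * L ^ K →
      HasMaj (BlockNorm.ofBlocks (unitTorusGeo L K M) (fun p : Tor (fine (L ^ n * L ^ K) M) × Fin (d + 1) => blockOf (L ^ n * L ^ K) M p.1))
        (BlockNorm.ofBlocks (unitTorusGeo L K M) (fun p : Tor (fine (L ^ n * L ^ K) M) × Fin (d + 1) => blockOf (L ^ n * L ^ K) M p.1))
        (symbOp M (L ^ n * L ^ K) (sT M (L ^ n * L ^ K) i ^ t - 1) ∘ₗ tensorId (Fin (d + 1)) (kingSOp L a msq (K + n) (L ^ n * L ^ K) M ν))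
        (fun y y' => C * ((t : ℝ) / ((L ^ n * L ^ K : ℕ) : ℝ)) ^ α * Real.exp (-(δ * tdistT M y y'))) := by
  obtain ⟨C, δ, hC, hδ, H⟩ := fullPropAdjOp_holder_le (d := d) L hLodd hL ha hm0 hα0 hα1
  refine ⟨C * Real.exp δ, δ, by positivity, hδ, fun K hK n e M _ hM msq hmsq hcap i ν t ht => ?_⟩
  have hKn : 1 ≤ K + n := le_add_right hK
  have hN : L ^ n * L ^ K = L ^ (K + n) := by rw [pow_add, mul_comm]
  have hN1 : 1 ≤ L ^ n * L ^ K := Nat.one_le_iff_ne_zero.mpr (NeZero.ne _)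
  have hN0 : (0 : ℝ) < ((L ^ n * L ^ K : ℕ) : ℝ) := by exact_mod_cast hN1
  have htN : t ≤ L ^ n * L ^ K := by omega
  have hq0 : 0 ≤ (t : ℝ) / ((L ^ n * L ^ K : ℕ) : ℝ) := div_nonneg (Nat.cast_nonneg _) hN0.le
  have hcoef : 0 ≤ C * Real.exp δ * ((t : ℝ) / ((L ^ n * L ^ K : ℕ) : ℝ)) ^ α := by positivity
  -- the scalar row, through the cube-format dictionary
  have hscal : HasMaj (BlockNorm.ofBlocks (unitTorusGeoS L K M 1) (blockOf (L ^ n * L ^ K) M))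
      (BlockNorm.ofBlocks (unitTorusGeoS L K M 1) (blockOf (L ^ n * L ^ K) M))
      ((pull (fun x : Tor (fine (L ^ n * L ^ K) M) => x + t • unitVec (fine (L ^ n * L ^ K) M) i) - LinearMap.id) ∘ₗ
        kingSOp L a msq (K + n) (L ^ n * L ^ K) M ν)
      (fun y y' => C * Real.exp δ * ((t : ℝ) / ((L ^ n * L ^ K : ℕ) : ℝ)) ^ α * Real.exp (-(δ * tdistT M y y'))) := by
    refine hasMaj_ofBlocks_of_cubeBound L _ _ _ hcoef fun lam F D hF x hD => ?_
    set x' : Tor (fine (L ^ n * L ^ K) M) := x + t • unitVec (fine (L ^ n * L ^ K) M) i with hx'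
    have hF0 : 0 ≤ F := (abs_nonneg _).trans (hF x)
    rw [LinearMap.comp_apply, LinearMap.sub_apply, Pi.sub_apply, pull_apply, LinearMap.id_apply, kingSOp_apply, kingSOp_apply]
    by_cases hxx : x' = x
    · -- no displacement: the difference vanishes
      rw [← hx', hxx, sub_self, abs_zero]
      positivity
    -- the block-distance hypotheses for both observation points, one unit weaker
    have hDx : ∀ y, lam y ≠ 0 → (D : ℝ) - 1 ≤ tdistT M (blockOf (L ^ n * L ^ K) M x) (blockOf (L ^ n * L ^ K) M y) := fun y hy => by
      linarith [hD y hy]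
    have hDx' : ∀ y, lam y ≠ 0 → (D : ℝ) - 1 ≤ tdistT M (blockOf (L ^ n * L ^ K) M x') (blockOf (L ^ n * L ^ K) M y) := fun y hy => by
      have h1 := hD y hy
      have h2 := tdistT_blockOf_add_smul_le M (L ^ n * L ^ K) x i htN
      have h3 := tdistT_triangle M (blockOf (L ^ n * L ^ K) M x) (blockOf (L ^ n * L ^ K) M x') (blockOf (L ^ n * L ^ K) M y)
      rw [tdistT_symm] at h2
      rw [hx'] at h3 ⊢
      linarith
    have key := H (K + n) hKn (L ^ n * L ^ K) hN e M hM msq hmsq hcap ν lam F ((D : ℝ) - 1) hF x x' hDx hDx'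
    -- the displacement is positive and at most `t`
    set s : ℝ := tdistT (fine (L ^ n * L ^ K) M) x x' with hs
    have hs1 : 1 ≤ s := one_le_tdistT_of_ne (fine (L ^ n * L ^ K) M) (Ne.symm hxx)
    have hst : s ≤ t := by rw [hs, hx']; exact tdistT_add_smul_unitVec_le (L ^ n * L ^ K) M x i t
    have hsN0 : 0 < s / ((L ^ n * L ^ K : ℕ) : ℝ) := div_pos (by linarith) hN0
    have hsN : s / ((L ^ n * L ^ K : ℕ) : ℝ) ≤ (t : ℝ) / ((L ^ n * L ^ K : ℕ) : ℝ) := div_le_div_of_nonneg_right hst hN0.le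
    rw [Real.rpow_neg hsN0.le, inv_mul_le_iff₀ (Real.rpow_pos_of_pos hsN0 α)] at key
    refine key.trans ?_
    have hexp : Real.exp (-(δ * ((D : ℝ) - 1))) = Real.exp δ * Real.exp (-(δ * D)) := by rw [← Real.exp_add]; ring_nf
    rw [hexp]
    have hpow : (s / ((L ^ n * L ^ K : ℕ) : ℝ)) ^ α ≤ ((t : ℝ) / ((L ^ n * L ^ K : ℕ) : ℝ)) ^ α := Real.rpow_le_rpow hsN0.le hsN hα0.le
    calc (s / ((L ^ n * L ^ K : ℕ) : ℝ)) ^ α * (C * (Real.exp δ * Real.exp (-(δ * D))) * F)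
        ≤ ((t : ℝ) / ((L ^ n * L ^ K : ℕ) : ℝ)) ^ α * (C * (Real.exp δ * Real.exp (-(δ * D))) * F) :=
          mul_le_mul_of_nonneg_right hpow (by positivity)
      _ = C * Real.exp δ * ((t : ℝ) / ((L ^ n * L ^ K : ℕ) : ℝ)) ^ α * Real.exp (-(δ * D)) * F := by ring
  rw [symbOp_sT_pow_sub_one_comp_tensorId]
  exact hasMaj_tensorId (Fin (d + 1)) (fun y y' => mul_nonneg hcoef (Real.exp_nonneg _)) hscal

end Steps

/-! ## §2 ★★ The sup upgrade of FILE 64's row (dag-n15-a K-I's interpolation, King edition) -/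

section Main

variable {L}

set_option maxHeartbeats 800000 in
/-- ★★ **THE CELL-OSCILLATION ROW OF `A₀⁻¹N∇*_ν` FOR KING's FULL `A = 0` PROPAGATOR, SUP-BLOCK CURRENCY, HYPOTHESIS-FREE.**  For odd `L ≥ 3`, `a > 0`, `m₀² ≥ 0`:
`∃ δ C > 0` such that for every `K ≥ 1`, refinement `n`, cube `M_μ = 2L^e`, mass `0 < m² ≤ m₀²`, direction `ν` and coloured fine multiplier `c′` with `|c′| ≤ r`
(`r ≥ 0`): `HasMaj (ofBlocks (unitTorusGeo L K M) (blkFine L K M)) (ofBlocks … (blockOf (L^n·L^K) M ∘ fst)) ((A₀′⁻¹N′∇′*_ν ⊗ 1)∘𝔇_{kingPrV}(M_{c′}, M_{blockAvg c′}))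
(C·r·(L^K)^{−1∕(8(d+1))}·e^{−δ|y−y′|_T})` — FILE 64's `L²`-row interpolated to sup by part 70 against §1's oscillation rows composed with the bounded diagonal
`𝔇(M_{c′}, M_{c̄}) ≤ 2r` (`K ≥ 8(d+1)`, sub-boxes of side `L^n·L^{K−j₀}`, `j₀ = ⌊K∕(4(d+1))⌋`), and the plain fine row of `A₀′⁻¹N′∇′*_ν` when `K < 8(d+1)` (then
`1 ≤ L·(L^K)^{−1∕(8(d+1))}`).  THE LOCATED INPUT OF THE KING JET's DRESSED THIRD ENTRY (dag-n15-d g21 «pure second source difference of `A₀⁻¹` over cells»),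
typed without any pointwise second-difference kernel bound. [cite: Balaban1985BackgroundPropagators, Thm 3.1 (3.42) p.397 (third entry, the row's consumer), (3.43)
p.398, (3.46) p.398, (3.52) p.400 (first-order species: shape); King1986, (2.13) p.653, (4.1)–(4.5) p.670, p.664 (pairing), Prop. 3.9 (3.73) p.665 (rate factor)] -/
theorem hasMaj_kingSOp_comp_idef_mulOp_blockAvg (hLodd : Odd L) (hL2 : 2 ≤ L) {a : ℝ} (ha : 0 < a) {m0sq : ℝ} (hm0 : 0 ≤ m0sq) :
    ∃ δ C : ℝ, 0 < δ ∧ 0 < C ∧ ∀ (K : ℕ), 1 ≤ K → ∀ (n e : ℕ) (M : Fin (d + 1) → ℕ) [∀ μ, NeZero (M μ)], (∀ μ, M μ = 2 * L ^ e) →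
      ∀ (msq : ℝ), 0 < msq → msq ≤ m0sq → ∀ (ν : Fin (d + 1)) (c' : Tor (fine (L ^ n * L ^ K) M) × Fin (d + 1) → ℝ) (r : ℝ), 0 ≤ r → (∀ z, |c' z| ≤ r) →
      HasMaj (BlockNorm.ofBlocks (unitTorusGeo L K M) (blkFine L K M))
        (BlockNorm.ofBlocks (unitTorusGeo L K M) (fun p : Tor (fine (L ^ n * L ^ K) M) × Fin (d + 1) => blockOf (L ^ n * L ^ K) M p.1))
        (tensorId (Fin (d + 1)) (kingSOp L a msq (K + n) (L ^ n * L ^ K) M ν) ∘ₗ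
          idef (pull (kingPrV L K n M)) (pull (kingPrV L K n M)) (mulOp c') (mulOp (blockAvg (kingPrV L K n M) c')))
        (fun y y' => C * r * ((L ^ K : ℕ) : ℝ) ^ (-(1 / (8 * ((d : ℝ) + 1)))) * Real.exp (-(δ * tdistT M y y'))) := by
  classical
  have hL0 : 0 < L := by omega
  have hLr1 : (1 : ℝ) ≤ (L : ℝ) := by exact_mod_cast (show 1 ≤ L by omega)
  have hLr0 : (0 : ℝ) < (L : ℝ) := by linarith
  obtain ⟨δ₂, C₂, hδ₂, hC₂, HE⟩ := hasMajL2_kingSOp_comp_idef_mulOp_blockAvg (d := d) hLodd hL2 ha hm0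
  obtain ⟨C₄, δ₄, hC₄, hδ₄, HH⟩ := hasMaj_steps_tensorId_kingSOp (d := d) hLodd hL2 ha hm0 (α := 1 / 2) (by norm_num) (by norm_num)
  obtain ⟨C₀, δ₅, hC₀, hδ₅, H5⟩ := hasMaj_kingSOp_fine (d := d) L hLodd hL2 ha hm0
  obtain ⟨δ, hδ⟩ : ∃ δ : ℝ, δ = min δ₂ (min δ₄ δ₅) := ⟨_, rfl⟩
  have hδpos : 0 < δ := by rw [hδ]; exact lt_min hδ₂ (lt_min hδ₄ hδ₅)
  have hδ2 : δ ≤ δ₂ := by rw [hδ]; exact min_le_left _ _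
  have hδ4 : δ ≤ δ₄ := by rw [hδ]; exact (min_le_right _ _).trans (min_le_left _ _)
  have hδ5 : δ ≤ δ₅ := by rw [hδ]; exact (min_le_right _ _).trans (min_le_right _ _)
  obtain ⟨Cbig, hCbig⟩ : ∃ Cbig : ℝ, Cbig = C₂ + 2 * ((d : ℝ) + 1) * Real.exp δ ^ (d + 1) * (2 * C₄ * (L : ℝ) ^ (1 / 2 : ℝ)) + 2 * C₀ * L := ⟨_, rfl⟩
  have hCbig0 : 0 ≤ Cbig := by rw [hCbig]; positivity
  refine ⟨δ, Cbig + 1, hδpos, by positivity, fun K hK n e M _ hM msq hmsq hcap ν c' r hr hc' => ?_⟩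
  have hn1 : 1 ≤ L ^ K := Nat.one_le_pow _ _ hL0
  have hn'1 : 1 ≤ L ^ n * L ^ K := Nat.one_le_iff_ne_zero.mpr (NeZero.ne _)
  have hn0 : (0 : ℝ) < ((L ^ K : ℕ) : ℝ) := by exact_mod_cast hn1
  have hnr1 : (1 : ℝ) ≤ ((L ^ K : ℕ) : ℝ) := by exact_mod_cast hn1
  have hncast : ((L ^ K : ℕ) : ℝ) = (L : ℝ) ^ K := by push_cast; ring
  obtain ⟨rt, hrt⟩ : ∃ rt : ℝ, rt = ((L ^ K : ℕ) : ℝ) ^ (-(1 / (8 * ((d : ℝ) + 1)))) := ⟨_, rfl⟩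
  have hrt0 : 0 ≤ rt := by rw [hrt]; exact Real.rpow_nonneg hn0.le _
  have hE : ∀ y y' : Tor M, 0 ≤ Real.exp (-(δ * tdistT M y y')) := fun _ _ => Real.exp_nonneg _
  -- the bounded diagonal `𝔇(M_{c′}, M_{c̄}) ≤ diagK 2r`
  have hblk : blkFine L K M ∘ kingPrV L K n M = fun i : Tor (fine (L ^ n * L ^ K) M) × Fin (d + 1) => blockOf (L ^ n * L ^ K) M i.1 := blkFine_comp_kingPrV _ L K n
  have hfit : HasMaj (BlockNorm.ofBlocks (unitTorusGeo L K M) (blkFine L K M))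
      (BlockNorm.ofBlocks (unitTorusGeo L K M) (fun z : Tor (fine (L ^ n * L ^ K) M) × Fin (d + 1) => blockOf (L ^ n * L ^ K) M z.1))
      (idef (pull (kingPrV L K n M)) (pull (kingPrV L K n M)) (mulOp c') (mulOp (blockAvg (kingPrV L K n M) c'))) (diagK fun _ => 2 * r) := by
    have h := hasMaj_idef_mulOp (g := unitTorusGeo L K M) (blkFine L K M) (kingPrV L K n M)
      (a' := c') (a := blockAvg (kingPrV L K n M) c') (o := fun _ => 2 * r) (fun _ => by positivity) fun z => by
        have h1 := hc' z
        have h2 := abs_blockAvg_le (kingPrV L K n M) hr hc' (kingPrV L K n M z)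
        calc |c' z - blockAvg (kingPrV L K n M) c' (kingPrV L K n M z)|
            ≤ |c' z| + |blockAvg (kingPrV L K n M) c' (kingPrV L K n M z)| := abs_sub _ _
          _ ≤ 2 * r := by linarith
    rw [hblk] at h
    exact h
  -- the plain fine row of `A₀′⁻¹N′∇′*_ν ⊗ 1`
  have HP' : HasMaj (BlockNorm.ofBlocks (unitTorusGeo L K M) (fun z : Tor (fine (L ^ n * L ^ K) M) × Fin (d + 1) => blockOf (L ^ n * L ^ K) M z.1))
      (BlockNorm.ofBlocks (unitTorusGeo L K M) (fun z : Tor (fine (L ^ n * L ^ K) M) × Fin (d + 1) => blockOf (L ^ n * L ^ K) M z.1))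
      (tensorId (Fin (d + 1)) (kingSOp L a msq (K + n) (L ^ n * L ^ K) M ν)) (fun y y' => C₀ * Real.exp (-(δ₅ * tdistT M y y'))) := by
    have h := H5 K hK n e M hM msq hmsq hcap 1 ν
    rw [blockOf_comp_underPtN] at h
    exact hasMaj_tensorId (Fin (d + 1)) (fun y y' => mul_nonneg hC₀.le (Real.exp_nonneg _)) h
  by_cases hkD : 8 * (d + 1) ≤ K
  · -- sub-boxes of side `ℓ = L^n·L^{K−j₀}`, `j₀ = ⌊K∕(4(d+1))⌋ ≥ 2`
    obtain ⟨j₀, hj₀⟩ : ∃ j₀ : ℕ, j₀ = K / (4 * (d + 1)) := ⟨_, rfl⟩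
    have hj₀2 : 2 ≤ j₀ := by
      rw [hj₀]; exact (Nat.le_div_iff_mul_le (by positivity)).mpr (by linarith)
    have hj₀k : j₀ ≤ K := by rw [hj₀]; exact Nat.div_le_self K (4 * (d + 1))
    have h4j : 4 * (j₀ * (d + 1)) ≤ K := by
      have := Nat.div_mul_le_self K (4 * (d + 1))
      rw [hj₀]; nlinarith [this]
    have hklt : K < 4 * (d + 1) * (j₀ + 1) := by rw [hj₀]; exact Nat.lt_mul_div_succ K (by positivity)
    obtain ⟨ℓ, hℓ⟩ : ∃ ℓ : ℕ, ℓ = L ^ n * L ^ (K - j₀) := ⟨_, rfl⟩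
    have hkj : L ^ (K - j₀) * L ^ j₀ = L ^ K := by rw [← pow_add, Nat.sub_add_cancel hj₀k]
    have hLj4 : 4 ≤ L ^ j₀ := le_trans (by nlinarith : 4 ≤ L ^ 2) (Nat.pow_le_pow_right hL0 hj₀2)
    have hℓ1 : 1 ≤ ℓ := by rw [hℓ]; exact Nat.one_le_iff_ne_zero.mpr (Nat.mul_ne_zero (pow_ne_zero n (by omega)) (pow_ne_zero _ (by omega)))
    have hℓfac : L ^ n * L ^ K = ℓ * L ^ j₀ := by rw [hℓ, mul_assoc, hkj]
    have hℓn : ℓ ∣ L ^ n * L ^ K := ⟨L ^ j₀, hℓfac⟩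
    have h4ℓ : 4 * ℓ ≤ L ^ n * L ^ K := by
      calc 4 * ℓ = L ^ n * (L ^ (K - j₀) * 4) := by rw [hℓ]; ring
        _ ≤ L ^ n * (L ^ (K - j₀) * L ^ j₀) := Nat.mul_le_mul_left _ (Nat.mul_le_mul_left _ hLj4)
        _ = L ^ n * L ^ K := by rw [hkj]
    have hquot : (L ^ n * L ^ K) / ℓ = L ^ j₀ := by
      rw [hℓfac, Nat.mul_div_cancel_left _ (by omega)]
    -- FILE 64's L²-block row, weakened to `(L^K)^{−1∕4}` and the common rate
    have h2 : HasMaj (BlockNorm.ofBlocks (unitTorusGeo L K M) (blkFine L K M))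
        (TwoGrid.BlockNorm.l2Blocks (unitTorusGeo L K M) (fun z : Tor (fine (L ^ n * L ^ K) M) × Fin (d + 1) => blockOf (L ^ n * L ^ K) M z.1)
          (etaPow (L ^ n * L ^ K) (d + 1)) (etaPow_nonneg _ _))
        (tensorId (Fin (d + 1)) (kingSOp L a msq (K + n) (L ^ n * L ^ K) M ν) ∘ₗ
          idef (pull (kingPrV L K n M)) (pull (kingPrV L K n M)) (mulOp c') (mulOp (blockAvg (kingPrV L K n M) c')))
        (fun y y' => C₂ * r * ((L ^ K : ℕ) : ℝ) ^ (-((1 : ℝ) / 2 / 2)) * Real.exp (-(δ * tdistT M y y'))) := by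
      refine (HE K hK n e M hM msq hmsq hcap ν c' r hr hc').mono fun y y' => ?_
      have hx4 : (((L ^ K : ℕ) : ℝ))⁻¹ ≤ ((L ^ K : ℕ) : ℝ) ^ (-((1 : ℝ) / 2 / 2)) := by
        rw [← Real.rpow_neg_one]; exact Real.rpow_le_rpow_of_exponent_le hnr1 (by norm_num)
      exact mul_le_mul (mul_le_mul_of_nonneg_left hx4 (mul_nonneg hC₂.le hr))
        (Real.exp_le_exp.mpr (neg_le_neg (mul_le_mul_of_nonneg_right hδ2 (tdistT_nonneg _ y y')))) (Real.exp_nonneg _) (by positivity)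
    -- the oscillations: §1's Hölder steps of `A₀′⁻¹N′∇′*_ν ⊗ 1` on the bounded diagonal
    have hosc : ∀ (i : Fin (d + 1)) (t : ℕ), t < ℓ → HasMaj (BlockNorm.ofBlocks (unitTorusGeo L K M) (blkFine L K M))
        (BlockNorm.ofBlocks (unitTorusGeo L K M) (fun z : Tor (fine (L ^ n * L ^ K) M) × Fin (d + 1) => blockOf (L ^ n * L ^ K) M z.1))
        (symbOp M (L ^ n * L ^ K) (sT M (L ^ n * L ^ K) i ^ t - 1) ∘ₗ
          (tensorId (Fin (d + 1)) (kingSOp L a msq (K + n) (L ^ n * L ^ K) M ν) ∘ₗ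
            idef (pull (kingPrV L K n M)) (pull (kingPrV L K n M)) (mulOp c') (mulOp (blockAvg (kingPrV L K n M) c'))))
        (fun y y' => 2 * C₄ * r * ((ℓ : ℝ) / ((L ^ n * L ^ K : ℕ) : ℝ)) ^ (1 / 2 : ℝ) * Real.exp (-(δ * tdistT M y y'))) := by
      intro i t ht
      have h4t : 4 * t ≤ L ^ n * L ^ K := le_trans (Nat.mul_le_mul_left 4 ht.le) h4ℓ
      have hH := HH K hK n e M hM msq hmsq hcap i ν t h4t
      have hcomp := hasMaj_comp_diagK_const (g := unitTorusGeo L K M) _ (blkFine L K M)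
        (mul_nonneg hC₄.le (Real.rpow_nonneg (div_nonneg (Nat.cast_nonneg _) (Nat.cast_nonneg _)) _)) hH hfit
      rw [LinearMap.comp_assoc] at hcomp
      refine hcomp.mono fun y y' => ?_
      have htl : ((t : ℝ) / ((L ^ n * L ^ K : ℕ) : ℝ)) ^ (1 / 2 : ℝ) ≤ ((ℓ : ℝ) / ((L ^ n * L ^ K : ℕ) : ℝ)) ^ (1 / 2 : ℝ) :=
        Real.rpow_le_rpow (div_nonneg (Nat.cast_nonneg _) (Nat.cast_nonneg _)) (div_le_div_of_nonneg_right (by exact_mod_cast ht.le) (Nat.cast_nonneg _)) (by norm_num)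
      show C₄ * ((t : ℝ) / ((L ^ n * L ^ K : ℕ) : ℝ)) ^ (1 / 2 : ℝ) * (2 * r) * Real.exp (-(δ₄ * (unitTorusGeo L K M).dist y y'))
        ≤ 2 * C₄ * r * ((ℓ : ℝ) / ((L ^ n * L ^ K : ℕ) : ℝ)) ^ (1 / 2 : ℝ) * Real.exp (-(δ * tdistT M y y'))
      calc C₄ * ((t : ℝ) / ((L ^ n * L ^ K : ℕ) : ℝ)) ^ (1 / 2 : ℝ) * (2 * r) * Real.exp (-(δ₄ * tdistT M y y'))
          ≤ C₄ * ((ℓ : ℝ) / ((L ^ n * L ^ K : ℕ) : ℝ)) ^ (1 / 2 : ℝ) * (2 * r) * Real.exp (-(δ * tdistT M y y')) :=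
            mul_le_mul (mul_le_mul_of_nonneg_right (mul_le_mul_of_nonneg_left htl hC₄.le) (by positivity))
              (Real.exp_le_exp.mpr (neg_le_neg (mul_le_mul_of_nonneg_right hδ4 (tdistT_nonneg _ y y')))) (Real.exp_nonneg _) (by positivity)
        _ = 2 * C₄ * r * ((ℓ : ℝ) / ((L ^ n * L ^ K : ℕ) : ℝ)) ^ (1 / 2 : ℝ) * Real.exp (-(δ * tdistT M y y')) := by ring
    have hmain := hasMaj_sup_of_l2Blocks_osc M K (L ^ n * L ^ K) hℓ1 hℓn (B₂ := C₂ * r * ((L ^ K : ℕ) : ℝ) ^ (-((1 : ℝ) / 2 / 2)))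
      (Bosc := 2 * C₄ * r * ((ℓ : ℝ) / ((L ^ n * L ^ K : ℕ) : ℝ)) ^ (1 / 2 : ℝ))
      (by positivity) hδpos.le h2 hosc
    refine hmain.mono fun y y' => mul_le_mul_of_nonneg_right ?_ (hE y y')
    -- rate bookkeeping (K-I's, part 71)
    rw [hquot, ← hrt]
    have hsq : Real.sqrt ((((L ^ j₀ : ℕ) : ℝ)) ^ (d + 1)) = Real.sqrt ((L : ℝ) ^ (j₀ * (d + 1))) := by
      push_cast; rw [← pow_mul]
    have h1 : Real.sqrt ((((L ^ j₀ : ℕ) : ℝ)) ^ (d + 1)) * (C₂ * r * ((L ^ K : ℕ) : ℝ) ^ (-((1 : ℝ) / 2 / 2))) ≤ C₂ * r * rt := by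
      rw [hsq, hncast, show (-((1 : ℝ) / 2 / 2)) = -(1 / 4 : ℝ) by norm_num]
      have hs := sqrt_pow_mul_rpow_le hLr1 h4j
      have hrt' : ((L : ℝ) ^ K) ^ (-(1 / 8 : ℝ)) ≤ rt := by
        rw [hrt, hncast]
        exact Real.rpow_le_rpow_of_exponent_le (one_le_pow₀ hLr1) (by
          rw [neg_le_neg_iff, one_div_le_one_div (by positivity) (by norm_num)]; have : (0 : ℝ) ≤ d := Nat.cast_nonneg d; nlinarith)
      calc Real.sqrt ((L : ℝ) ^ (j₀ * (d + 1))) * (C₂ * r * ((L : ℝ) ^ K) ^ (-(1 / 4 : ℝ)))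
          = C₂ * r * (Real.sqrt ((L : ℝ) ^ (j₀ * (d + 1))) * ((L : ℝ) ^ K) ^ (-(1 / 4 : ℝ))) := by ring
        _ ≤ C₂ * r * rt := mul_le_mul_of_nonneg_left (hs.trans hrt') (mul_nonneg hC₂.le hr)
    have h2' : ((ℓ : ℝ) / ((L ^ n * L ^ K : ℕ) : ℝ)) ^ (1 / 2 : ℝ) ≤ (L : ℝ) ^ (1 / 2 : ℝ) * rt := by
      have e : (ℓ : ℝ) / ((L ^ n * L ^ K : ℕ) : ℝ) = ((L : ℝ) ^ j₀)⁻¹ := by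
        have hℓ0 : (ℓ : ℝ) ≠ 0 := by exact_mod_cast (by omega : ℓ ≠ 0)
        rw [hℓfac]
        push_cast
        rw [← div_div, div_self hℓ0, one_div]
      rw [e, hrt, hncast, show (1 / (8 * ((d : ℝ) + 1))) = 1 / (2 * (((4 * (d + 1) : ℕ) : ℝ))) by push_cast; ring]
      exact pow_rpow_neg_half_le hLr1 (by positivity) hklt
    calc Real.sqrt ((((L ^ j₀ : ℕ) : ℝ)) ^ (d + 1)) * (C₂ * r * ((L ^ K : ℕ) : ℝ) ^ (-((1 : ℝ) / 2 / 2)))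
          + 2 * ((d : ℝ) + 1) * Real.exp δ ^ (d + 1) * (2 * C₄ * r * ((ℓ : ℝ) / ((L ^ n * L ^ K : ℕ) : ℝ)) ^ (1 / 2 : ℝ))
        ≤ C₂ * r * rt + 2 * ((d : ℝ) + 1) * Real.exp δ ^ (d + 1) * (2 * C₄ * r * ((L : ℝ) ^ (1 / 2 : ℝ) * rt)) := by
          gcongr
      _ = (Cbig - 2 * C₀ * L) * r * rt := by rw [hCbig]; ring
      _ ≤ (Cbig + 1) * r * rt := mul_le_mul_of_nonneg_right (mul_le_mul_of_nonneg_right (by nlinarith [hC₀.le, hLr0.le]) hr) hrt0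
  · -- `K < 8(d+1)`: the plain row `(A₀′⁻¹N′∇′*_ν ⊗ 1)∘diagK 2r`, `1 ≤ L·rt`
    have hap := hasMaj_comp_diagK_const (g := unitTorusGeo L K M) _ (blkFine L K M) hC₀.le HP' hfit
    have hLrt : 1 ≤ (L : ℝ) * rt := by
      rw [hrt, hncast, ← Real.rpow_natCast (L : ℝ) K, ← Real.rpow_mul hLr0.le]
      have e : (L : ℝ) * (L : ℝ) ^ ((K : ℝ) * -(1 / (8 * ((d : ℝ) + 1)))) = (L : ℝ) ^ (1 + (K : ℝ) * -(1 / (8 * ((d : ℝ) + 1)))) := by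
        rw [Real.rpow_add hLr0, Real.rpow_one]
      rw [e]
      refine Real.one_le_rpow hLr1 ?_
      have hk8 : (K : ℝ) < 8 * ((d : ℝ) + 1) := by
        have : ((K : ℕ) : ℝ) < ((8 * (d + 1) : ℕ) : ℝ) := by exact_mod_cast (by omega : K < 8 * (d + 1))
        push_cast at this; linarith
      have hpos : (0 : ℝ) < 8 * ((d : ℝ) + 1) := by positivity
      rw [show (K : ℝ) * -(1 / (8 * ((d : ℝ) + 1))) = -((K : ℝ) / (8 * ((d : ℝ) + 1))) by ring]
      have : (K : ℝ) / (8 * ((d : ℝ) + 1)) < 1 := by rw [div_lt_one hpos]; exact hk8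
      linarith
    refine hap.mono fun y y' => ?_
    rw [← hrt]
    show C₀ * (2 * r) * Real.exp (-(δ₅ * tdistT M y y')) ≤ (Cbig + 1) * r * rt * Real.exp (-(δ * tdistT M y y'))
    calc C₀ * (2 * r) * Real.exp (-(δ₅ * tdistT M y y')) ≤ C₀ * (2 * r) * Real.exp (-(δ * tdistT M y y')) :=
          mul_le_mul_of_nonneg_left (Real.exp_le_exp.mpr (neg_le_neg (mul_le_mul_of_nonneg_right hδ5 (tdistT_nonneg _ y y')))) (by positivity)
      _ ≤ C₀ * (2 * r) * ((L : ℝ) * rt) * Real.exp (-(δ * tdistT M y y')) := by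
          have h0 : 0 ≤ C₀ * (2 * r) * Real.exp (-(δ * tdistT M y y')) := by positivity
          nlinarith
      _ = (2 * C₀ * L) * r * rt * Real.exp (-(δ * tdistT M y y')) := by ring
      _ ≤ (Cbig + 1) * r * rt * Real.exp (-(δ * tdistT M y y')) := by
          refine mul_le_mul_of_nonneg_right (mul_le_mul_of_nonneg_right (mul_le_mul_of_nonneg_right ?_ hr) hrt0) (hE y y')
          rw [hCbig]
          have : 0 ≤ C₂ + 2 * ((d : ℝ) + 1) * Real.exp δ ^ (d + 1) * (2 * C₄ * (L : ℝ) ^ (1 / 2 : ℝ)) := by positivity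
          linarith

end Main

end Summit.QuantumFields.YangMills.BalabanUVNodes.N15.KingModel.SrcDiv
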